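import Summits.AtomisticToContinuum.Crystallization.Theorems.ThreeConeCertificateOnePercentCertificateFccWindowKernel
import Summits.AtomisticToContinuum.Crystallization.Theorems.FrustratedLawDichotomyRangeCut
import HarnessLib

/-!
# `e⋆ ≤ −0.7175` and `UP(−0.7175)` WITH STANDARD AXIOMS (the fcc window through the kernel certificate)

`…OnePercentCertificateFccWindow.eStar_le` / `…PeriodicEnergyCeiling.periodicEnergyCeiling_holds` (binder `UP(−0.7175)` = `PeriodicEnergyCeiling (−0.7175)` of every
27623 junction; discharged only on the COMPUTATIONAL lane `…RecordJunctionFree` / `…CollarCensusZeroFree` / `…RecordJunctionCoreFree`) rest on the `native_decide` fact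
`sumBoxQ_le`.  `…OnePercentCertificateFccWindowKernel.sumBoxQ_le_kernel` (hand-2 g35) proves the same inequality by kernel reduction; this DEF-FREE module redraws the
four consequences from it, VERBATIM the proofs of the tree with the one lemma swapped — axiom upgrades of the tree statements (same statements, trust base
{propext, Classical.choice, Quot.sound}):

* `sum_box_le` — the real box sum `≤ −1.4350`;
* `energyPerParticle_fccPC_aW_le` — `e(fcc, √0.943) ≤ −0.7175`;
* ★ `eStar_le` — `e⋆ ≤ −0.7175`;
* ★★ `periodicEnergyCeiling_holds` — `UP(−0.7175)`, and `periodicEnergyCeiling_of_le`.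

decomp-a2c hand-2 g35 (structural share on stmt-AtomisticToContinuum-27623).  0 sorry; no definitions; no `native_decide`.  [folklore; certified computation]
-/

noncomputable section

namespace Summit.AtomisticToContinuum.Crystallization.Theorems.FrustratedLawDichotomyPeriodicEnergyCeilingKernel

open scoped BigOperators
open Literature.MathematicalPhysics.StatisticalMechanics
open Summit.AtomisticToContinuum.Crystallization.Theorems
open Summit.AtomisticToContinuum.Crystallization.Theorems.LayeredLawsSelectHcp.Negative.FccLattice (fccD3 le_dist_of_mem_fccD3)
open Summit.AtomisticToContinuum.Crystallization.Theorems.LayeredLawsSelectHcp.Negative.FccEnergy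
  (fccPC energyPerParticle_fccPC summable_abs_lennardJones_fccD3 eStar_le_energyPerParticle_fccPC)
open Summit.AtomisticToContinuum.Crystallization.Theorems.ChargedEnergyGapNegative (eStar)
open Summit.AtomisticToContinuum.Crystallization.Theorems.OnePercentFccRung (lennardJones_nonpos_of_half_le)
open Summit.AtomisticToContinuum.Crystallization.Theorems.OnePercentFccWindow (boxW sumBoxQ aW aW_pos aW_sq aW_ne_zero gW gW_mem gW_injective sum_box_eq)
open Summit.AtomisticToContinuum.Crystallization.Theorems.OnePercentFccWindowKernel (sumBoxQ_le_kernel)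
open Summit.AtomisticToContinuum.Crystallization.Theorems.FrustratedLawDichotomyRangeCut (PeriodicEnergyCeiling)

/-- **The box sum is `≤ −1.4350`** over `ℝ` — the statement of `…FccWindow.sum_box_le`, through the kernel certificate. [certified computation] -/
theorem sum_box_le : ∑ t ∈ boxW, lennardJones ‖gW t‖ ≤ -(14350 / 10000) := by
  rw [sum_box_eq]
  have h' : ((sumBoxQ : ℚ) : ℝ) ≤ ((-(14350 / 10000) : ℚ) : ℝ) := Rat.cast_le.2 sumBoxQ_le_kernel
  simpa using h'

set_option maxRecDepth 16384 in
/-- **`e(fcc at nearest-neighbour distance √0.943) ≤ −0.7175`** — the statement of `…FccWindow.energyPerParticle_fccPC_aW_le`, proof verbatim with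
`sum_box_le` of this module (every other lattice term is `≤ 0`); as there, membership in the concrete box needs a larger recursion depth. [folklore] -/
theorem energyPerParticle_fccPC_aW_le :
    (fccPC aW_ne_zero).energyPerParticle lennardJones ≤ -(7175 / 10000) := by
  rw [energyPerParticle_fccPC]
  set T := {y : EuclideanSpace ℝ (Fin 3) // y ∈ (fccD3 aW : Set (EuclideanSpace ℝ (Fin 3))) ∧ y ≠ 0}
  set f : T → ℝ := fun y => lennardJones ‖(y : EuclideanSpace ℝ (Fin 3))‖ with hf
  have hsum : Summable f := (summable_abs_lennardJones_fccD3 aW_ne_zero).of_abs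
  have hnonpos : ∀ y : T, f y ≤ 0 := fun y => by
    have h1 : aW ≤ ‖(y : EuclideanSpace ℝ (Fin 3))‖ := by
      have := le_dist_of_mem_fccD3 aW_pos y.2.1 (fccD3 aW).zero_mem y.2.2
      rwa [dist_zero_right] at this
    have hpos : 0 < ‖(y : EuclideanSpace ℝ (Fin 3))‖ := aW_pos.trans_le h1
    refine lennardJones_nonpos_of_half_le hpos ?_
    calc (1 / 2 : ℝ) ≤ aW ^ 6 := by
          rw [show aW ^ 6 = (aW ^ 2) ^ 3 by ring, aW_sq]; norm_num
      _ ≤ ‖(y : EuclideanSpace ℝ (Fin 3))‖ ^ 6 := pow_le_pow_left₀ aW_pos.le h1 6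
  let e : {t // t ∈ boxW} ↪ T :=
    ⟨fun t => ⟨gW t.1, gW_mem t.2⟩, fun s t h =>
      Subtype.ext (gW_injective (congrArg (fun y : T => (y : EuclideanSpace ℝ (Fin 3))) h))⟩
  let S : Finset T := boxW.attach.map e
  have hS : ∑ y ∈ S, f y = ∑ t ∈ boxW, lennardJones ‖gW t‖ := by
    rw [Finset.sum_map, ← Finset.sum_attach boxW]
    exact Finset.sum_congr rfl fun t _ => rfl
  have hval : ∑ t ∈ boxW, lennardJones ‖gW t‖ ≤ -(14350 / 10000) := sum_box_le
  have hsplit := hsum.sum_add_tsum_compl (s := S)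
  have htail : ∑' y : ↥((↑S : Set T)ᶜ), f y ≤ 0 := tsum_nonpos fun y => hnonpos y
  have htot : ∑' y : T, f y ≤ -(14350 / 10000) := by
    rw [← hsplit, hS]; linarith
  linarith

/-- ★ **`e⋆ ≤ −0.7175`** for the periodic infimum — the statement of `…FccWindow.eStar_le`, standard axioms. [folklore] -/
theorem eStar_le : eStar ≤ -(7175 / 10000) :=
  (eStar_le_energyPerParticle_fccPC aW_ne_zero).trans energyPerParticle_fccPC_aW_le

/-- ★★ **`UP(−0.7175)` HOLDS, standard axioms** — the statement of `…PeriodicEnergyCeiling.periodicEnergyCeiling_holds` (the binder `hU` of the 27623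
junctions): the fcc configuration at nearest-neighbour distance `√0.943` has energy per particle `≤ −0.7175`. [folklore] -/
theorem periodicEnergyCeiling_holds : PeriodicEnergyCeiling (-(7175 / 10000)) :=
  ⟨_, energyPerParticle_fccPC_aW_le⟩

/-- `UP(eUp)` for every `eUp ≥ −0.7175`, standard axioms. [folklore] -/
theorem periodicEnergyCeiling_of_le {eUp : ℝ} (h : -(7175 / 10000) ≤ eUp) : PeriodicEnergyCeiling eUp := by
  obtain ⟨Q, hQ⟩ := periodicEnergyCeiling_holds
  exact ⟨Q, hQ.trans h⟩

end Summit.AtomisticToContinuum.Crystallization.Theorems.FrustratedLawDichotomyPeriodicEnergyCeilingKernel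

end
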